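import Summits.NavierStokesRegularity.NavierStokesRegularity.Theorems.QuietScarPocketDoorDefs
import Literature.Analysis.FunctionSpaces.Complexify

/-!
# CalmPocketDoorDefs — door S32 «CalmPocketDoor» (the EXTERIOR door: no hypothesis in the core): texts of record + the
# kernel-checked compositions (plate P0)

Texts of record: nsreg-p1 g25 `r30/Sketch32.lean` v2 sha16 d8e333116c9f1838 (ROUND-30 v2 fc0b67deb4cc2d26; lit §R172 PASS,
bc7 8/8), §0–§3 landed VERBATIM — every declaration below is the sketch's, with the two `local notation` lines removed
(the notations for `EuclideanSpace ℝ (Fin 3)` and `EuclideanSpace ℂ (Fin 3)` spelled out) and two docstrings added on the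
compositions — by ns-imp-p1 g4 on LEAD ns-s30-p1 g2's word 11:59:45Z (S-door lane, DIRECTOR-NS #209 (2)),
`--supports stmt-NavierStokesRegularity-0056 --as helper`.  The open statements are `def … : Prop` texts (no proof
placeholders); the plates F32 `ExteriorTraceTube`, Q32 `PocketPropagation`, I32 `TerminalValueIdentification`, PT32
`FrameTransfer32`, the S-lemma to `BP21CalmShellRegularity` from the Barker–Prange Literature fact, and the closers land in
their own `Theorems/CalmPocketDoor*.lean` files.
WHAT THIS IS NOT: a regularity CRITERION about the exterior terminal profile of a HYPOTHETICAL blow-up (Type II cores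
allowed in the class), conditional on Barker–Prange 2021 Prop. 10; item 0056 `NoTypeII` and NS regularity are NOT proved;
nothing here is a route or a summit statement.

## The sketch's own header (nsreg-p1 g25), verbatim

Sketch32 — ROUND-30 door S32 «CalmPocketDoor» (EXTERIOR door: no hypothesis in the core)

nsreg-p1 g25, 2026-08-28 (cell sketch, farm-checked, NOT proposed).

DOOR S32 (unit frame `ν = 1`, window `[0,1)`, apex `(1, 0)`, pocket scale `1`).  Let `(u,p)` be classical on
`[0,1) × ℝ³` and Leray–Hopf on `[0,1]` from `u 0`, with the CRITICAL DATUM BOUND `‖u 0‖_{L³(ℝ³)} ≤ M` and the EXTERIOR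
BOUNDS `‖u‖ ≤ M`, `|p| ≤ M` on `(0,1) × {¼ < ‖x‖ < 2R}` — NOTHING is assumed in the core `(0,1) × B(0,¼)` (Type II
allowed).  If the velocity is terminally `ε`-CALM on ONE exterior pocket `B(x₁, κ)`, `1 ≤ ‖x₁‖ ≤ R/2` —
`‖u(t,x)‖ ≤ ε` eventually as `t ↑ 1`, pointwise on the pocket — then `(1,0)` is regular (`IsBackwardBoundedAt u 1 0`).
Here `ε = ε(M,κ) > 0`, `R = R(M) ≥ 2`; the memo ROUND-30 gives them EXPLICITLY (a tower in `M`): the door is the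
first EFFECTIVE pocket door, and the first pocket door WITHOUT a Type-I hypothesis.

CHAIN.  (F) exterior terminal VELOCITY trace `U₁` on `A_R = {½ ≤ ‖x‖ ≤ R}` with a holomorphic extension bounded by
`K₀(M)` on the complex `r₀(M)`-tube over `A_R` (LEG F of S31, velocity form, localised: BGK floating slices — tree
`unitFloatingSliceCore_holds` p623372, `terminalUniformRadius_holds` p624616, PF-c SCV limit);  (Q) POCKET → SHELL
PROPAGATION OF SMALLNESS for real slices of bounded holomorphic functions on a tube (pure complex analysis; effective
via the two-segment Chebyshev lemma `TwoSegmentLemma`, or non-effective via Montel + identity theorem);  (I) the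
Leray–Hopf value `u 1` equals the trace `U₁` a.e. on `A_R`;  (BP) Barker–Prange 2021 Prop. 10 [arXiv:2003.06717 §4.3,
p. 25]: `‖u 0‖₃ ≤ M` and `u 1` small on the thick shell `{1 ≤ ‖x‖ ≤ R_BP(M)}` ⇒ `(1,0)` regular — a NAMED FACT
(quantitative Carleman backward uniqueness; the print has `L³(shell)`-smallness, we use the weaker a.e.-sup form).
Composition `calmPocketRegularity_of` PROVED below.  0056 is NOT proved; this is a regularity criterion.
-/

noncomputable section

open MeasureTheory Set Function Filter Topology TopologicalSpace Metric
open scoped RealInnerProductSpace Topology ENNReal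
open Literature.Analysis Literature.Analysis.FluidPDE
open Literature.Analysis.FunctionSpaces.EuclideanSpace (complexify)

set_option linter.dupNamespace false

namespace Summit.NavierStokesRegularity.NavierStokesRegularity.Theorems.CalmPocketDoor

/-! ### §0 Geometry: the exterior shell and complex tubes -/

/-- The closed exterior shell `A_R = {½ ≤ ‖x‖ ≤ R}` (connected for `R ≥ 2`; contains every pocket `B(x₁,κ)` with
`1 ≤ ‖x₁‖ ≤ R/2`, `κ ≤ ½`, and the Barker–Prange shell `{1 ≤ ‖x‖ ≤ R_BP}` once `R ≥ R_BP`). -/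
def shell (R : ℝ) : Set (EuclideanSpace ℝ (Fin 3)) := {x | 1 / 2 ≤ ‖x‖ ∧ ‖x‖ ≤ R}

/-- The complex `r`-tube over a real set `A ⊆ ℝ³`: `⋃_{x ∈ A} B(complexify x, r)` in `ℂ^3`. -/
def cTube (A : Set (EuclideanSpace ℝ (Fin 3))) (r : ℝ) : Set (EuclideanSpace ℂ (Fin 3)) := ⋃ x ∈ A, ball (complexify x) r

/-- **Tube data of a real field on the shell**: `U₁ : ℝ³ → ℝ³` is, on `A_R`, the real slice of a map `F` holomorphic on
the `r₀`-tube over `A_R` and bounded there by `K₀`. -/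
def HasTubeExtension (R r₀ K₀ : ℝ) (U₁ : (EuclideanSpace ℝ (Fin 3)) → (EuclideanSpace ℝ (Fin 3))) : Prop :=
  ∃ F : (EuclideanSpace ℂ (Fin 3)) → (EuclideanSpace ℂ (Fin 3)), DifferentiableOn ℂ F (cTube (shell R) r₀) ∧ (∀ z ∈ cTube (shell R) r₀, ‖F z‖ ≤ K₀) ∧
    ∀ x ∈ shell R, F (complexify x) = complexify (U₁ x)

/-! ### §1 The door texts -/

/-- **EXTERIOR HYPOTHESES at `(M, R)`** (unit frame): classical on `[0,1) × ℝ³`, Leray–Hopf on `[0,1]` from `u 0`,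
critical datum bound `‖u 0‖_{L³} ≤ M`, and the exterior sup bounds `‖u‖, |p| ≤ M` on `(0,1) × {¼ < ‖x‖ < 2R}`.
Nothing in the core. -/
def ExteriorClass (M R : ℝ) (u : ℝ → (EuclideanSpace ℝ (Fin 3)) → (EuclideanSpace ℝ (Fin 3))) (p : ℝ → (EuclideanSpace ℝ (Fin 3)) → ℝ) : Prop :=
  IsClassicalNSSolutionOn (Ico (0 : ℝ) 1) 1 0 u p ∧ IsLerayHopfOn 1 1 0 (u 0) u ∧
    eLpNorm (u 0) 3 volume ≤ ENNReal.ofReal M ∧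
    ∀ t ∈ Ioo (0 : ℝ) 1, ∀ x : (EuclideanSpace ℝ (Fin 3)), 1 / 4 < ‖x‖ → ‖x‖ < 2 * R → ‖u t x‖ ≤ M ∧ |p t x| ≤ M

/-- **door S32 at `(M, κ)` (unit frame).**  Some `ε > 0` and `R ≥ 4` such that every `(u,p)` of the exterior class
`(M,R)` whose velocity is terminally `ε`-calm on ONE exterior pocket `B(x₁,κ)`, `1 ≤ ‖x₁‖ ≤ R/2` — `‖u(t,x)‖ ≤ ε`
eventually as `t ↑ 1`, for each `x` of the pocket — is regular at the apex `(1, 0)`. -/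
def CalmPocketRegularityAt (M κ : ℝ) : Prop :=
  ∃ ε : ℝ, 0 < ε ∧ ∃ R : ℝ, 4 ≤ R ∧ ∀ (u : ℝ → (EuclideanSpace ℝ (Fin 3)) → (EuclideanSpace ℝ (Fin 3))) (p : ℝ → (EuclideanSpace ℝ (Fin 3)) → ℝ), ExteriorClass M R u p →
    (∃ x₁ : (EuclideanSpace ℝ (Fin 3)), 1 ≤ ‖x₁‖ ∧ ‖x₁‖ ≤ R / 2 ∧ ∀ x ∈ ball x₁ κ, ∀ᶠ t in 𝓝[<] (1 : ℝ), ‖u t x‖ ≤ ε) →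
    IsBackwardBoundedAt u 1 0

/-- **door S32 (unit frame):** every datum/exterior level `M > 0`, every aperture `κ ∈ (0, ½]` (larger apertures follow
by monotonicity: a calm `B(x₁,κ')`, `κ' ≥ κ`, contains a calm `B(x₁,κ)`). -/
def CalmPocketRegularity : Prop :=
  ∀ M : ℝ, 0 < M → ∀ κ : ℝ, 0 < κ → κ ≤ 1 / 2 → CalmPocketRegularityAt M κ

/-- **door S32 at `(ν, M, κ)` (physical frame).**  Classical on `[0,T)`, Leray–Hopf on `[0,T]`; a point `x₀`, a scale
`λ > 0` with `λ² ≤ νT`; the critical DATUM bound `‖u(t)‖_{L³(ℝ³)} ≤ Mν` on the EARLY half-window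
`(T − λ²/ν, T − λ²/(2ν))` ONLY (never up to `T`: an `L³` bound on the whole terminal window would make the door a
corollary of Escauriaza–Seregin–Šverák `L^∞_t L³_x` regularity — v1 pitfall, fixed in v2) and, on the terminal window
`(T − λ²/ν, T)` × the exterior region `{λ/8 < ‖x−x₀‖ < 4Rλ}`, `‖u‖ ≤ Mν/λ`, `|p| ≤ Mν²/λ²` — NOTHING in the core
`B(x₀, λ/8)`; ONE calm pocket `B(x₁, κλ)`, `λ ≤ ‖x₁−x₀‖ ≤ Rλ/2`: `λ‖u(t,x)‖ ≤ νε` eventually as `t ↑ T` ⇒ `(x₀,T)`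
regular.  (`L³` on a half-window rather than at one instant: the frame transfer restarts the Leray–Hopf evolution at
a.e. time `s ∈ (T − λ²/ν, T − λ²/(2ν))` and rescales by `μ = √(ν(T−s)) ∈ [λ/√2, λ]`; the factors `⅛`, `4R` absorb `μ/λ`.) -/
def TargetCalmPocketAt (ν M κ : ℝ) : Prop :=
  ∃ ε : ℝ, 0 < ε ∧ ∃ R : ℝ, 2 ≤ R ∧ ∀ (u : ℝ → (EuclideanSpace ℝ (Fin 3)) → (EuclideanSpace ℝ (Fin 3))) (p : ℝ → (EuclideanSpace ℝ (Fin 3)) → ℝ) (T : ℝ), 0 < T →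
    IsClassicalNSSolutionOn (Ico 0 T) ν 0 u p → IsLerayHopfOn T ν 0 (u 0) u →
    ∀ (x₀ : (EuclideanSpace ℝ (Fin 3))) (lam : ℝ), 0 < lam → lam ^ 2 ≤ ν * T →
    (∀ t ∈ Ioo (T - lam ^ 2 / ν) (T - lam ^ 2 / (2 * ν)), eLpNorm (u t) 3 volume ≤ ENNReal.ofReal (M * ν)) →
    (∀ t ∈ Ioo (T - lam ^ 2 / ν) T, ∀ x : (EuclideanSpace ℝ (Fin 3)), lam / 8 < ‖x - x₀‖ → ‖x - x₀‖ < 4 * R * lam →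
      ‖u t x‖ ≤ M * ν / lam ∧ |p t x| ≤ M * ν ^ 2 / lam ^ 2) →
    (∃ x₁ : (EuclideanSpace ℝ (Fin 3)), lam ≤ ‖x₁ - x₀‖ ∧ ‖x₁ - x₀‖ ≤ R * lam / 2 ∧
      ∀ x ∈ ball x₁ (κ * lam), ∀ᶠ t in 𝓝[<] T, lam * ‖u t x‖ ≤ ν * ε) →
    IsBackwardBoundedAt u T x₀

/-- **door S32 (physical frame).** -/
def TargetCalmPocket : Prop :=
  ∀ ν : ℝ, 0 < ν → ∀ M : ℝ, 0 < M → ∀ κ : ℝ, 0 < κ → κ ≤ 1 / 2 → TargetCalmPocketAt ν M κ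

/-- **PT32 · FRAME TRANSFER (support, routine):** translation, Leray–Hopf restart at a.e. time `s` of
`(T − λ²/ν, T − λ²/(2ν))` (tree `IsLerayHopfOn.ae_isLerayHopfOn_restart`), parabolic rescaling of `[s,T]` to `[0,1]` by
`μ = √(ν(T−s)) ∈ [λ/√2, λ]`, viscosity normalisation `v(τ,y) = (μ/ν) u(s + μ²τ/ν, x₀ + μy)`; the `L³` bound, the exterior
bounds and the calm-pocket hypothesis are scale-covariant (`‖u(s)‖₃/ν`, `λ‖u‖/ν` dimensionless) and land in the unit class
`(M, 2R)` with pocket `1 ≤ ‖y₁‖ ≤ R`, aperture `κ`; `IsBackwardBoundedAt` transfers back. -/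
def FrameTransfer32 : Prop := CalmPocketRegularity → TargetCalmPocket

/-! ### §2 The plates -/

/-- **PLATE F32 · EXTERIOR TERMINAL VELOCITY TRACE WITH TUBE EXTENSION** (LEG F of S31, velocity form, localised to
the shell; no Type I): for the exterior class `(M,R)` the velocities `u(t,·)` converge UNIFORMLY on the shell `A_R` as
`t ↑ 1` to a field `U₁` which has tube data `(r₀, K₀)` depending only on `(M, R)`.
[tree: `unitFloatingSliceCore_holds` (p623372), `terminalUniformRadius_holds` (p624616), `terminalSliceVelocityAnalyticity_holds`
(p625220) and the PF-c SCV limit lemma — run on the unit cylinders `(1−c,1) × B(x,⅛)`, `x ∈ A_R`, inside the exterior region.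
why it might fail: bookkeeping only (uniformity of the BGK radius/bound over the shell; gluing local extensions by the
identity theorem on overlapping complex balls).] -/
def ExteriorTraceTube : Prop :=
  ∀ M R : ℝ, 0 < M → 2 ≤ R → ∃ r₀ K₀ : ℝ, 0 < r₀ ∧ 0 < K₀ ∧
    ∀ (u : ℝ → (EuclideanSpace ℝ (Fin 3)) → (EuclideanSpace ℝ (Fin 3))) (p : ℝ → (EuclideanSpace ℝ (Fin 3)) → ℝ), ExteriorClass M R u p →
      ∃ U₁ : (EuclideanSpace ℝ (Fin 3)) → (EuclideanSpace ℝ (Fin 3)), TendstoUniformlyOn (fun t => u t) U₁ (𝓝[<] (1 : ℝ)) (shell R) ∧ HasTubeExtension R r₀ K₀ U₁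

/-- **PLATE Q32 · POCKET → SHELL PROPAGATION OF SMALLNESS** (pure complex analysis): for tube data `(R, r₀, K₀)` and an
aperture `κ ≤ ½`, every target level `δ > 0` on the shell is guaranteed by some calmness level `ε > 0` on one pocket
`B(x₁,κ)`, `1 ≤ ‖x₁‖ ≤ R/2`.  [Effective proof: chain of `N ≍ (R + 4)/min(r₀,κ)` applications of `TwoSegmentLemma`
along polygonal paths in `A_R`, giving `δ = C K₀ (ε/(C K₀))^{θ^N}`; soft proof: Montel + identity theorem on the connected
tube.  why it might fail: it cannot (classical); the effective constant is the content of the memo.] -/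
def PocketPropagation : Prop :=
  ∀ R r₀ K₀ κ δ : ℝ, 2 ≤ R → 0 < r₀ → 0 < K₀ → 0 < κ → κ ≤ 1 / 2 → 0 < δ → ∃ ε : ℝ, 0 < ε ∧
    ∀ (U₁ : (EuclideanSpace ℝ (Fin 3)) → (EuclideanSpace ℝ (Fin 3))) (x₁ : (EuclideanSpace ℝ (Fin 3))), HasTubeExtension R r₀ K₀ U₁ → 1 ≤ ‖x₁‖ → ‖x₁‖ ≤ R / 2 →
      (∀ x ∈ ball x₁ κ, ‖U₁ x‖ ≤ ε) → ∀ x ∈ shell R, ‖U₁ x‖ ≤ δ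

/-- **TWO-SEGMENT LEMMA (the effective engine of Q32; optional plate, stated in `∃ (C, θ)` form):** a function holomorphic
on the disc `D(0,16ρ)` and bounded by `K` there, which is `≤ η` on the real segment `[−ρ, ρ]`, is `≤ C K^{1−θ} η^θ` on
`[−2ρ, 2ρ]`.  (Taylor truncation at degree `n ≍ log₈(K/η)` + Chebyshev's extremal inequality `|P(x)| ≤ T_n(|x|) sup_{[-1,1]}|P|`
give `C = 5`, `θ = ⅓`.)  [Chebyshev / Remez; why it might fail: it cannot.] -/
def TwoSegmentLemma : Prop :=
  ∃ C θ : ℝ, 0 < C ∧ 0 < θ ∧ θ < 1 ∧ ∀ (g : ℂ → ℂ) (ρ K η : ℝ), 0 < ρ → 0 < η → η ≤ K →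
    DifferentiableOn ℂ g (ball (0 : ℂ) (16 * ρ)) → (∀ z ∈ ball (0 : ℂ) (16 * ρ), ‖g z‖ ≤ K) →
    (∀ t : ℝ, |t| ≤ ρ → ‖g t‖ ≤ η) → ∀ t : ℝ, |t| ≤ 2 * ρ → ‖g t‖ ≤ C * K ^ (1 - θ) * η ^ θ

/-- **PLATE I32 · TERMINAL VALUE = TRACE a.e.** (routine): the Leray–Hopf value `u 1` (weak `L²` continuity at `t = 1`)
agrees a.e. on the shell with the uniform limit `U₁` of the classical slices. (folklore; why it might fail: it cannot.) -/
def TerminalValueIdentification : Prop :=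
  ∀ (u : ℝ → (EuclideanSpace ℝ (Fin 3)) → (EuclideanSpace ℝ (Fin 3))) (R : ℝ) (U₁ : (EuclideanSpace ℝ (Fin 3)) → (EuclideanSpace ℝ (Fin 3))), IsLerayHopfOn 1 1 0 (u 0) u →
    (∀ t ∈ Ioo (0 : ℝ) 1, ContinuousOn (u t) (shell R)) →
    TendstoUniformlyOn (fun t => u t) U₁ (𝓝[<] (1 : ℝ)) (shell R) →
    ∀ᵐ x ∂(volume.restrict (shell R)), u 1 x = U₁ x

/-- **FACT BP32 · BARKER–PRANGE 2021, PROPOSITION 10** [T. Barker, C. Prange, *Quantitative regularity for the Navier–Stokes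
equations via spatial concentration*, CMP 385 (2021), arXiv:2003.06717, §4.3 Prop. 10, p. 25]: "for `M` large, a suitable
finite-energy solution on `ℝ³ × [−1,0]` with `‖u(−1)‖₃ ≤ M` and `‖u(0)‖_{L³(B(exp((M♭)^{1221})) ∖ B(1))} ≤ exp(−exp((M♭)^{1223}))`
is regular at `(0,0)`."  Transcribed on the window `[0,1]` (terminal time `1`), for the class «classical on `[0,1) × ℝ³` +
Leray–Hopf on `[0,1]`» (⊆ suitable finite-energy), with the shell-smallness hypothesis in the STRONGER a.e.-sup form
(⇒ the `L³(shell)` bound) — hence never stronger than print; `∀ M > 0` by monotonicity in `M`.  A NAMED FACT (to be filed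
under `Literature/…` by a typer; used here as a hypothesis). -/
def BP21CalmShellRegularity : Prop :=
  ∀ M : ℝ, 0 < M → ∃ R δ : ℝ, 1 < R ∧ 0 < δ ∧ ∀ (u : ℝ → (EuclideanSpace ℝ (Fin 3)) → (EuclideanSpace ℝ (Fin 3))) (p : ℝ → (EuclideanSpace ℝ (Fin 3)) → ℝ),
    IsClassicalNSSolutionOn (Ico (0 : ℝ) 1) 1 0 u p → IsLerayHopfOn 1 1 0 (u 0) u →
    eLpNorm (u 0) 3 volume ≤ ENNReal.ofReal M →
    (∀ᵐ x ∂(volume.restrict {x : (EuclideanSpace ℝ (Fin 3)) | 1 ≤ ‖x‖ ∧ ‖x‖ ≤ R}), ‖u 1 x‖ ≤ δ) →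
    IsBackwardBoundedAt u 1 0

/-! ### §3 Composition: F32 + Q32 + I32 + BP32 ⇒ door S32 (unit frame); + PT32 ⇒ physical frame -/

/-- **COMPOSITION (unit frame): F32 + Q32 + I32 + BP32 ⇒ door S32 `CalmPocketRegularity`.** -/
theorem calmPocketRegularity_of (hF : ExteriorTraceTube) (hQ : PocketPropagation)
    (hI : TerminalValueIdentification) (hBP : BP21CalmShellRegularity) : CalmPocketRegularity := by
  intro M hM κ hκ hκh
  obtain ⟨R₁, δ, hR₁, hδ, hbp⟩ := hBP M hM
  set R : ℝ := max 4 R₁ with hRdef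
  have hR4 : 4 ≤ R := le_max_left _ _
  have hR2 : 2 ≤ R := by linarith
  have hR₁R : R₁ ≤ R := le_max_right _ _
  obtain ⟨r₀, K₀, hr₀, hK₀, hF'⟩ := hF M R hM hR2
  obtain ⟨ε, hε, hQ'⟩ := hQ R r₀ K₀ κ δ hR2 hr₀ hK₀ hκ hκh hδ
  refine ⟨ε, hε, R, hR4, ?_⟩
  intro u p hcl hpocket
  obtain ⟨x₁, hx₁, hx₁R, hcalm⟩ := hpocket
  obtain ⟨U₁, htend, htube⟩ := hF' u p hcl
  -- the pocket lies in the shell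
  have hpocket_sub : ball x₁ κ ⊆ shell R := by
    intro x hx
    rw [mem_ball] at hx
    have h1 : ‖x₁‖ - κ < ‖x‖ := by
      have := norm_sub_norm_le x₁ x
      rw [← dist_eq_norm, dist_comm] at this
      linarith
    have h2 : ‖x‖ < ‖x₁‖ + κ := by
      have := norm_sub_norm_le x x₁
      rw [← dist_eq_norm] at this
      linarith
    refine ⟨by linarith, by linarith⟩
  -- calmness passes to the trace on the pocket
  have hU₁calm : ∀ x ∈ ball x₁ κ, ‖U₁ x‖ ≤ ε := by
    intro x hx
    have ht : Tendsto (fun t => u t x) (𝓝[<] (1 : ℝ)) (𝓝 (U₁ x)) := htend.tendsto_at (hpocket_sub hx)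
    have ht' : Tendsto (fun t => ‖u t x‖) (𝓝[<] (1 : ℝ)) (𝓝 ‖U₁ x‖) := ht.norm
    exact le_of_tendsto ht' (hcalm x hx)
  -- propagation to the whole shell
  have hshell : ∀ x ∈ shell R, ‖U₁ x‖ ≤ δ := hQ' U₁ x₁ htube hx₁ hx₁R hU₁calm
  -- identification of the Leray–Hopf value with the trace, a.e. on the shell
  obtain ⟨hcls, hLH, hL3, hext⟩ := hcl
  have hcont : ∀ t ∈ Ioo (0 : ℝ) 1, ContinuousOn (u t) (shell R) := by
    intro t ht
    exact (hcls.contDiff_velocity (S := Ico (0 : ℝ) 1) ⟨ht.1.le, ht.2⟩).continuous.continuousOn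
  have hae : ∀ᵐ x ∂(volume.restrict (shell R)), u 1 x = U₁ x := hI u R U₁ hLH hcont htend
  -- a.e. sup bound on the Barker–Prange shell
  have hsub : {x : (EuclideanSpace ℝ (Fin 3)) | 1 ≤ ‖x‖ ∧ ‖x‖ ≤ R₁} ⊆ shell R := by
    intro x hx; exact ⟨by linarith [hx.1], hx.2.trans hR₁R⟩
  have hae' : ∀ᵐ x ∂(volume.restrict {x : (EuclideanSpace ℝ (Fin 3)) | 1 ≤ ‖x‖ ∧ ‖x‖ ≤ R₁}), ‖u 1 x‖ ≤ δ := by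
    have h1 : ∀ᵐ x ∂(volume.restrict (shell R)), x ∈ shell R → ‖u 1 x‖ ≤ δ := by
      filter_upwards [hae] with x hx hxs
      rw [hx]; exact hshell x hxs
    have h2 : ∀ᵐ x ∂(volume.restrict (shell R)), ‖u 1 x‖ ≤ δ := by
      have hmeas : MeasurableSet (shell R) := by
        have : shell R = (fun x : (EuclideanSpace ℝ (Fin 3)) => ‖x‖) ⁻¹' Icc (1 / 2) R := by
          ext x; simp [shell, mem_Icc]
        rw [this]
        exact measurableSet_Icc.preimage continuous_norm.measurable
      have hm : ∀ᵐ x ∂(volume.restrict (shell R)), x ∈ shell R := ae_restrict_mem hmeas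
      filter_upwards [h1, hm] with x h hx using h hx
    exact ae_restrict_of_ae_restrict_of_subset hsub h2
  exact hbp u p hcls hLH hL3 hae'

/-- **COMPOSITION (physical frame): + PT32 ⇒ `TargetCalmPocket`.** -/
theorem targetCalmPocket_of (hF : ExteriorTraceTube) (hQ : PocketPropagation) (hI : TerminalValueIdentification)
    (hBP : BP21CalmShellRegularity) (hT : FrameTransfer32) : TargetCalmPocket :=
  hT (calmPocketRegularity_of hF hQ hI hBP)

end Summit.NavierStokesRegularity.NavierStokesRegularity.Theorems.CalmPocketDoor
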